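import Mathlib
import HarnessLib
import Summits.HubbardSuperconductivity.HubbardSuperconductivity.Theorems.KLProgrammeKLRegimeFatMultiplierIncrementPairSymbol
import Summits.HubbardSuperconductivity.HubbardSuperconductivity.Theorems.KLProgrammeKLRegimeFatMultiplierPack
import Summits.HubbardSuperconductivity.HubbardSuperconductivity.Theorems.KLProgrammeKLRegimeSliceTangencyBridge
import Summits.HubbardSuperconductivity.HubbardSuperconductivity.Theorems.KLProgrammeKLRegimeSymbolFrameProfileThird

/-!
# Route `KLProgramme` — crux K3 ENGINE (stmt-…-20437) stub (b) conj. 2 «(c-D)² FAMILY TELESCOPE», brick (D2b-rest, part 2): sup, support, cell and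
# tangency datum of the fat INCREMENT pair `(F̃^{K_o}_ω − F̃^{K}_ω)·F̃^{K}_{ω′}` of `bgmFatMultiplier` across two frames

Cell `gate-hubbard-kl`, seat hubbard-kl-k3c3-p2 (g10); F1-DESIGN §7 (vi)–(viii), §9.  The differences of the increment pair are the landed instances
(`norm_fwdDiff_iter_space_fatIncrPair_le` p585208, `…_time_…` p585374, `…_tangent_…` (L4)) keyed by the identification `bgmFatIncr_mul_bgmFat_eq_symbol`; this file
supplies the remaining multiplier data of `slicePairWt_charSum_l1_le` for the increment pair, all reduced to the PLAIN pair's: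

* **support inclusion** `Gs^Δ q ≠ 0 ⇒ F̃^K_ω(k q)·F̃^K_{ω′}(k q) ≠ 0` (the increment factor shares the angular part of `F̃^K_ω`, the plain factor carries the `K`-shell),
  hence the plain support COUNT (`card_support_fatPair_le`), the plain CELL (`fatPair_cell`: support within `ρ_f` of `p_F(θ_ω)`) and the plain TANGENCY datum on the
  support (`sliceTangency_of_cell`);
* **sup** `‖Gs^Δ‖ ≤ (de₀²/Λ_m²)·P₀(2(Λ_m + P₀) + P₀)` — the amplitude `A = C₁W₀` of the chain export, every term carrying the piece `|ν| ≤ P₀`.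

* **`bgmFatIncrPair_data`** — the five facts bundled.

Everything is proved; no definitions, no sorry.  Nothing asserts superconductivity. [cite: BenfattoGiulianiMastropietro2006, §2.5 (2.46)–(2.50), §2.7 (2.66)–(2.71a)]
-/

noncomputable section

namespace Summit.HubbardSuperconductivity.HubbardSuperconductivity.Theorems.TorusFourierL2

set_option linter.dupNamespace false -- summit = problem name (single-conjunct summit), D-0017

open Set Finset Filter Topology Literature.MathematicalPhysics.QuantumLattice Literature.MathematicalPhysics.QuantumLattice.BandSectorCounting
open Literature.MathematicalPhysics.QuantumLattice.FermiRG Literature.Probability.LatticeModels Literature.Analysis.SpecialFunctions Literature.Analysis.Calculus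
open Summit.HubbardSuperconductivity.HubbardSuperconductivity.Theorems.DispersionFlow
open Summit.HubbardSuperconductivity.HubbardSuperconductivity.Theorems.KLRegimeSplit
open Summit.HubbardSuperconductivity.HubbardSuperconductivity.Theorems.KLProgrammeLegKernels
open Summit.HubbardSuperconductivity.HubbardSuperconductivity.Theorems.PerturbedFermiCurve
open scoped Real Nat

section IncrPairData

open Classical

variable {L M : ℕ} [NeZero L] [NeZero M] {a b : ℝ} (B : BandBounds a b) {K : TrigPolyC4v} (Ko : TrigPolyC4v) {A : ℝ}
  (hA : ∀ p : Momentum, ∀ j ≤ 2, ‖iteratedFDeriv ℝ j (frameShift K) p‖ ≤ A) (hADt : 2 * A < B.Dtmin)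
  {μ e₀ z β : ℝ} (he : 0 < e₀) (hz : 0 < z) (hz1 : z ≤ 1) (hgap : e₀ + A + z ^ 2 < -μ) (h3 : e₀ + A - μ ≤ 3)
  (hlo : a ≤ μ - A - e₀) (hhi : μ + A + e₀ ≤ b) (hβ : 0 < β) (hρA : 4 * A < 2 * B.rhomin)
  (m : ℕ)
  {d : ℝ} (hd : 0 ≤ d) (hd1 : ∀ u, |deriv (bgmCutoffSq e₀) u| ≤ d) (hd2 : ∀ u, |iteratedDeriv 2 (bgmCutoffSq e₀) u| ≤ d)
  (hd3 : ∀ u, |iteratedDeriv 3 (bgmCutoffSq e₀) u| ≤ d)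
  {K₂ : ℝ} (hK₂ : ∀ p, ‖iteratedFDeriv ℝ 2 (frameLevel μ K) p‖ ≤ K₂)
  -- the piece `ν = e_K − e_{K_o}` on `Fin 2 → ℝ` and its size
  {ν : (Fin 2 → ℝ) → ℝ} (hν : ∀ p, ν p = frameLevel μ K (WithLp.toLp 2 p) - frameLevel μ Ko (WithLp.toLp 2 p)) {P₀ : ℝ} (hN₀ : ∀ p, |ν p| ≤ P₀)
  {ρf : ℝ}
  (hρf : ρf = (klScale e₀ m + B.smax * B.Dtmin * (3 * sectorWidth (m + 1) / 4)) / (B.Dtmin - 2 * A) +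
    π * Real.sqrt 2 * (1 + (4 + 2 * A) / (B.Dtmin - 2 * A)) * sectorWidth (m + 1))

include B hA hADt he hz hz1 hgap h3 hlo hhi hβ hρA hd hd1 hd2 hd3 hK₂ hν hN₀ hρf in
set_option maxHeartbeats 1600000 in
/-- **Multiplier data of the fat INCREMENT pair** `Gs^Δ = (F̃^{K_o}_ω − F̃^{K}_ω)·F̃^{K}_{ω′}` (sampled at the product-torus labels): (1) sup `≤ (de₀²/Λ_m²)·P₀(2(Λ_m+P₀)+P₀)`;
(2) support inclusion in the plain pair's; (3) support count (the plain bound); (4) every support point lies within `ρ_f` (sup norm) of `p_F(θ_ω)`; (5) the Euclidean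
tangency datum of the frame band `e_K` on the support along the integer vector `v`, from the tangency `τ₀` at `p_F(θ_ω)`.
[cite: BenfattoGiulianiMastropietro2006, §2.5 (2.46)–(2.50), §2.7 (2.66)–(2.71a)] -/
theorem bgmFatIncrPair_data (ω ω' : Fin (sectorCount (m + 1))) (v : Fin 2 → ℤ) {τ₀ : ℝ}
    (hvtan : |fderiv ℝ (fun p : Fin 2 → ℝ => frameLevel μ K (WithLp.toLp 2 p)) (klFermiPoint μ K (sectorCenter (m + 1) (ω : ℕ)))
      (fun j => 2 * π / L * (v j : ℝ))| ≤ τ₀)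
    (Gs : TorusSite 1 (2 * M) × TorusSite 2 L → ℂ)
    (hGsdef : Gs = fun q => bgmFatMultiplier L M e₀ β (nambuXiCT L μ Ko) (m + 1) ω (⟨(q.1 0).val, ZMod.val_lt (q.1 0)⟩, q.2) *
        bgmFatMultiplier L M e₀ β (nambuXiCT L μ K) (m + 1) ω' (⟨(q.1 0).val, ZMod.val_lt (q.1 0)⟩, q.2) -
      bgmFatMultiplier L M e₀ β (nambuXiCT L μ K) (m + 1) ω (⟨(q.1 0).val, ZMod.val_lt (q.1 0)⟩, q.2) *
        bgmFatMultiplier L M e₀ β (nambuXiCT L μ K) (m + 1) ω' (⟨(q.1 0).val, ZMod.val_lt (q.1 0)⟩, q.2)) :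
    (∀ q, ‖Gs q‖ ≤ d * e₀ ^ 2 / klScale e₀ m ^ 2 * (P₀ * (2 * (klScale e₀ m + P₀) + P₀))) ∧
    (∀ q, Gs q ≠ 0 → bgmFatMultiplier L M e₀ β (nambuXiCT L μ K) (m + 1) ω (⟨(q.1 0).val, ZMod.val_lt (q.1 0)⟩, q.2) *
        bgmFatMultiplier L M e₀ β (nambuXiCT L μ K) (m + 1) ω' (⟨(q.1 0).val, ZMod.val_lt (q.1 0)⟩, q.2) ≠ 0) ∧
    ((((univ.filter fun q => Gs q ≠ 0).card : ℕ) : ℝ) ≤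
      (klScale e₀ m * β / π + 1) *
        ((Real.sqrt 2 * L * ((klScale e₀ m + (4 + 4 * A) * ρf ^ 2) / (2 * B.rhomin - 4 * A)) / π + 2) *
          (Real.sqrt 2 * L * (2 * ρf) / π + 2))) ∧
    (∀ q, Gs q ≠ 0 → ‖torusCentredMomentum L q.2 - klFermiPoint μ K (sectorCenter (m + 1) (ω : ℕ))‖ ≤ ρf) ∧
    (∀ q, Gs q ≠ 0 → |fderiv ℝ (frameLevel μ K) (WithLp.toLp 2 (torusCentredMomentum L q.2)) (WithLp.toLp 2 (fun i => 2 * π / L * (v i : ℝ)))| ≤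
      τ₀ + K₂ * (Real.sqrt 2 * ρf) * ‖(WithLp.toLp 2 (fun i => 2 * π / L * (v i : ℝ)) : EuclideanSpace ℝ (Fin 2))‖) := by
  have hL : (0 : ℝ) < L := Nat.cast_pos.2 (Nat.pos_of_ne_zero (NeZero.ne L))
  have hπ := Real.pi_pos
  have hΛ : 0 < klScale e₀ m := by rw [klScale]; positivity
  have hP0 : 0 ≤ P₀ := (abs_nonneg _).trans (hN₀ 0)
  have hA0 : 0 ≤ A := (norm_nonneg _).trans (hA 0 0 (by norm_num))
  have hDt : 0 < B.Dtmin - 2 * A := by linarith only [hADt]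
  have hw : 0 < sectorWidth (m + 1) := sectorWidth_pos (m + 1)
  have hlo' : a ≤ μ - A := by linarith only [hlo, he]
  have hhi' : μ + A ≤ b := by linarith only [hhi, he]
  -- the objects
  obtain ⟨S₁, hS₁⟩ : ∃ S₁ : Finset ℕ, S₁ = (range (sectorCount (m + 1))).filter
      (fun ω₁ : ℕ => ∃ δ : ℤ, |δ| ≤ 1 ∧ (sectorCount (m + 1) : ℤ) ∣ ((ω₁ : ℤ) - ((ω : ℕ) : ℤ) - δ)) := ⟨_, rfl⟩
  obtain ⟨S₂, hS₂⟩ : ∃ S₂ : Finset ℕ, S₂ = (range (sectorCount (m + 1))).filter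
      (fun ω₁ : ℕ => ∃ δ : ℤ, |δ| ≤ 1 ∧ (sectorCount (m + 1) : ℤ) ∣ ((ω₁ : ℤ) - ((ω' : ℕ) : ℤ) - δ)) := ⟨_, rfl⟩
  have hS₁r : S₁ ⊆ range (sectorCount (m + 1)) := by rw [hS₁]; exact fatNbr_subset_range (m + 1) ω
  have hS₂r : S₂ ⊆ range (sectorCount (m + 1)) := by rw [hS₂]; exact fatNbr_subset_range (m + 1) ω'
  obtain ⟨Z, hZdef⟩ : ∃ Z : (Fin 2 → ℝ) → ℝ, Z = fun p => gnCutoff ((π + z) ^ 2 / π ^ 2) ((π + z) ^ 2) (p 0 ^ 2) * gnCutoff ((π + z) ^ 2 / π ^ 2) ((π + z) ^ 2) (p 1 ^ 2) *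
    ((radialCutoffC (1 / 2) (momToComplex p) * ∑ a' ∈ S₁, sectorWeightCirc (m + 1) ((a' : ℕ) : ℤ) (polarAngle p)) *
      (radialCutoffC (1 / 2) (momToComplex p) * ∑ b' ∈ S₂, sectorWeightCirc (m + 1) ((b' : ℕ) : ℤ) (polarAngle p))) := ⟨_, rfl⟩
  have hZ : ∀ p, Z p = gnCutoff ((π + z) ^ 2 / π ^ 2) ((π + z) ^ 2) (p 0 ^ 2) * gnCutoff ((π + z) ^ 2 / π ^ 2) ((π + z) ^ 2) (p 1 ^ 2) *
    ((radialCutoffC (1 / 2) (momToComplex p) * ∑ a' ∈ S₁, sectorWeightCirc (m + 1) ((a' : ℕ) : ℤ) (polarAngle p)) *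
      (radialCutoffC (1 / 2) (momToComplex p) * ∑ b' ∈ S₂, sectorWeightCirc (m + 1) ((b' : ℕ) : ℤ) (polarAngle p))) :=
    fun p => by rw [hZdef]
  set eK : (Fin 2 → ℝ) → ℝ := fun p => frameLevel μ K (WithLp.toLp 2 p) with heK
  set G : ℝ → ℝ := fun u => bgmCutoffSq e₀ ((16 : ℝ) ^ m * u) with hGdef
  obtain ⟨hGc, hG0, hG1, -, -, hGv⟩ := scaleProfile_bounds₃ he m hd1 hd2 hd3
  -- the plain symbol and the increment symbol
  obtain ⟨Φp, hΦpdef⟩ : ∃ Φp : ℝ × (Fin 2 → ℝ) → ℂ, Φp = fun x => ((bgmCutoffSq e₀ ((16 : ℝ) ^ m * (x.1 ^ 2 + frameLevel μ K (WithLp.toLp 2 x.2) ^ 2)) *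
      bgmCutoffSq e₀ ((16 : ℝ) ^ m * (x.1 ^ 2 + frameLevel μ K (WithLp.toLp 2 x.2) ^ 2)) * Z x.2 : ℝ) : ℂ) := ⟨_, rfl⟩
  have hΦp : ∀ k₀ p, Φp (k₀, p) = ((bgmCutoffSq e₀ ((16 : ℝ) ^ m * (k₀ ^ 2 + frameLevel μ K (WithLp.toLp 2 p) ^ 2)) *
      bgmCutoffSq e₀ ((16 : ℝ) ^ m * (k₀ ^ 2 + frameLevel μ K (WithLp.toLp 2 p) ^ 2)) * Z p : ℝ) : ℂ) := fun k₀ p => by rw [hΦpdef]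
  obtain ⟨Φ, hΦdef⟩ : ∃ Φ : ℝ × (Fin 2 → ℝ) → ℂ, Φ = fun x => (((bgmCutoffSq e₀ ((16 : ℝ) ^ m * (x.1 ^ 2 + (frameLevel μ K (WithLp.toLp 2 x.2) - ν x.2) ^ 2)) -
      bgmCutoffSq e₀ ((16 : ℝ) ^ m * (x.1 ^ 2 + frameLevel μ K (WithLp.toLp 2 x.2) ^ 2))) *
      (bgmCutoffSq e₀ ((16 : ℝ) ^ m * (x.1 ^ 2 + frameLevel μ K (WithLp.toLp 2 x.2) ^ 2)) * Z x.2) : ℝ) : ℂ) := ⟨_, rfl⟩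
  have hΦ : ∀ k₀ p, Φ (k₀, p) = (((bgmCutoffSq e₀ ((16 : ℝ) ^ m * (k₀ ^ 2 + (frameLevel μ K (WithLp.toLp 2 p) - ν p) ^ 2)) -
      bgmCutoffSq e₀ ((16 : ℝ) ^ m * (k₀ ^ 2 + frameLevel μ K (WithLp.toLp 2 p) ^ 2))) *
      (bgmCutoffSq e₀ ((16 : ℝ) ^ m * (k₀ ^ 2 + frameLevel μ K (WithLp.toLp 2 p) ^ 2)) * Z p) : ℝ) : ℂ) := fun k₀ p => by rw [hΦdef]
  -- the plain pair and the two identifications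
  set Gp : TorusSite 1 (2 * M) × TorusSite 2 L → ℂ := fun q =>
      bgmFatMultiplier L M e₀ β (nambuXiCT L μ K) (m + 1) ω (⟨(q.1 0).val, ZMod.val_lt (q.1 0)⟩, q.2) *
        bgmFatMultiplier L M e₀ β (nambuXiCT L μ K) (m + 1) ω' (⟨(q.1 0).val, ZMod.val_lt (q.1 0)⟩, q.2) with hGpdef
  have hGpΦ : ∀ q, Gp q = Φp (π * (1 - 2 * M) / β + 2 * π / β * (((q.1 0).val : ℕ) : ℝ), fun j => 2 * π / L * (((q.2 j).valMinAbs : ℤ) : ℝ)) := by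
    intro q; rw [hGpdef]
    subst hS₁ hS₂
    exact bgmFat_mul_bgmFat_eq_symbol hA he hz h3 m ω ω' hZ hΦp q
  have hGsΦ : ∀ q, Gs q = Φ (π * (1 - 2 * M) / β + 2 * π / β * (((q.1 0).val : ℕ) : ℝ), fun j => 2 * π / L * (((q.2 j).valMinAbs : ℤ) : ℝ)) := by
    intro q; rw [hGsdef]
    subst hS₁ hS₂
    exact bgmFatIncr_mul_bgmFat_eq_symbol Ko hA he hz h3 m ω ω' hZ hν hΦ q
  -- (2) support inclusion at the symbol level
  have hincl : ∀ k₀ p, Φ (k₀, p) ≠ 0 → G (k₀ ^ 2 + eK p ^ 2) ≠ 0 ∧ Z p ≠ 0 := by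
    intro k₀ p hne
    rw [hΦ, Complex.ofReal_ne_zero] at hne
    obtain ⟨-, hQ⟩ := mul_ne_zero_iff.1 hne
    exact mul_ne_zero_iff.1 hQ
  have hincl' : ∀ q, Gs q ≠ 0 → Gp q ≠ 0 := by
    intro q hq
    rw [hGsΦ] at hq
    obtain ⟨hGne, hZne⟩ := hincl _ _ hq
    rw [hGpΦ, hΦp, Complex.ofReal_ne_zero]
    exact mul_ne_zero (mul_ne_zero hGne hGne) hZne
  -- (1) the sup: `|G(u + W) − G(u)|·|G(u) Z| ≤ C₁·|W| ≤ C₁·P₀(2(Λ+P₀)+P₀)`, or both profiles vanish far from the shell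
  have hZ1 : ∀ p, |Z p| ≤ 1 := abs_fatAngular_le_one hZ hS₁r hS₂r
  have hGdiff : ∀ x y : ℝ, ‖G y - G x‖ ≤ d * e₀ ^ 2 / klScale e₀ m ^ 2 * ‖y - x‖ := by
    intro x y
    refine Convex.norm_image_sub_le_of_norm_deriv_le (s := Set.univ) (fun u _ => (hGc.differentiable (by norm_num) u)) ?_ convex_univ
      (Set.mem_univ x) (Set.mem_univ y)
    intro u _; rw [Real.norm_eq_abs]; exact hG1 u
  have hsup : ∀ k₀ p, ‖Φ (k₀, p)‖ ≤ d * e₀ ^ 2 / klScale e₀ m ^ 2 * (P₀ * (2 * (klScale e₀ m + P₀) + P₀)) := by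
    intro k₀ p
    have hC₁ : 0 ≤ d * e₀ ^ 2 / klScale e₀ m ^ 2 := by positivity
    rw [hΦ, Complex.norm_real, Real.norm_eq_abs, abs_mul, abs_mul]
    have hQle : |bgmCutoffSq e₀ ((16 : ℝ) ^ m * (k₀ ^ 2 + frameLevel μ K (WithLp.toLp 2 p) ^ 2))| * |Z p| ≤ 1 :=
      le_trans (mul_le_mul (hG0 _) (hZ1 p) (abs_nonneg _) zero_le_one) (le_of_eq (one_mul _))
    have hQ0 : 0 ≤ |bgmCutoffSq e₀ ((16 : ℝ) ^ m * (k₀ ^ 2 + frameLevel μ K (WithLp.toLp 2 p) ^ 2))| * |Z p| := by positivity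
    -- the increment factor
    have hI : |bgmCutoffSq e₀ ((16 : ℝ) ^ m * (k₀ ^ 2 + (frameLevel μ K (WithLp.toLp 2 p) - ν p) ^ 2)) -
        bgmCutoffSq e₀ ((16 : ℝ) ^ m * (k₀ ^ 2 + frameLevel μ K (WithLp.toLp 2 p) ^ 2))| ≤
        d * e₀ ^ 2 / klScale e₀ m ^ 2 * (P₀ * (2 * (klScale e₀ m + P₀) + P₀)) := by
      by_cases hfar : klScale e₀ m + P₀ < |eK p|
      · -- both arguments exceed `Λ²`
        have h1 : klScale e₀ m < |eK p| := by linarith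
        have h2 : klScale e₀ m < |eK p - ν p| := by
          have := abs_sub_abs_le_abs_sub (eK p) (ν p); linarith [hN₀ p]
        have sq1 : klScale e₀ m ^ 2 < k₀ ^ 2 + eK p ^ 2 := by
          have h := pow_lt_pow_left₀ h1 hΛ.le two_ne_zero
          rw [sq_abs] at h; exact lt_of_lt_of_le h (le_add_of_nonneg_left (sq_nonneg k₀))
        have sq2 : klScale e₀ m ^ 2 < k₀ ^ 2 + (eK p - ν p) ^ 2 := by
          have h := pow_lt_pow_left₀ h2 hΛ.le two_ne_zero
          rw [sq_abs] at h; exact lt_of_lt_of_le h (le_add_of_nonneg_left (sq_nonneg k₀))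
        have z1 : bgmCutoffSq e₀ ((16 : ℝ) ^ m * (k₀ ^ 2 + frameLevel μ K (WithLp.toLp 2 p) ^ 2)) = 0 := hGv _ sq1
        have z2 : bgmCutoffSq e₀ ((16 : ℝ) ^ m * (k₀ ^ 2 + (frameLevel μ K (WithLp.toLp 2 p) - ν p) ^ 2)) = 0 := hGv _ sq2
        rw [z1, z2, sub_zero, abs_zero]; positivity
      · have hnear : |eK p| ≤ klScale e₀ m + P₀ := not_lt.1 hfar
        have hW : ‖(k₀ ^ 2 + (eK p - ν p) ^ 2) - (k₀ ^ 2 + eK p ^ 2)‖ ≤ P₀ * (2 * (klScale e₀ m + P₀) + P₀) := by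
          rw [Real.norm_eq_abs, show (k₀ ^ 2 + (eK p - ν p) ^ 2) - (k₀ ^ 2 + eK p ^ 2) = -(ν p * (2 * eK p - ν p)) by ring, abs_neg, abs_mul]
          refine mul_le_mul (hN₀ p) ((abs_sub _ _).trans ?_) (abs_nonneg _) hP0
          rw [abs_mul, abs_two]; linarith [hN₀ p]
        have h := hGdiff (k₀ ^ 2 + eK p ^ 2) (k₀ ^ 2 + (eK p - ν p) ^ 2)
        rw [Real.norm_eq_abs] at h
        exact h.trans (mul_le_mul_of_nonneg_left hW hC₁)
    calc _ ≤ d * e₀ ^ 2 / klScale e₀ m ^ 2 * (P₀ * (2 * (klScale e₀ m + P₀) + P₀)) * 1 :=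
          mul_le_mul hI hQle hQ0 (by positivity)
      _ = _ := mul_one _
  have h1 : ∀ q, ‖Gs q‖ ≤ d * e₀ ^ 2 / klScale e₀ m ^ 2 * (P₀ * (2 * (klScale e₀ m + P₀) + P₀)) := fun q => by rw [hGsΦ]; exact hsup _ _
  -- (3) the count through the plain pair
  have hδ : ∀ a' ∈ S₁, ‖klFermiPoint μ K (sectorCenter (m + 1) a') - klFermiPoint μ K (sectorCenter (m + 1) (ω : ℕ))‖ ≤
      π * Real.sqrt 2 * (1 + (4 + 2 * A) / (B.Dtmin - 2 * A)) * sectorWidth (m + 1) :=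
    fun a' ha' => norm_klFermiPoint_fatNbr_sub_le B hA hlo' hhi' hADt (m + 1) ω (hS₁ ▸ ha')
  have hδF0 : 0 ≤ π * Real.sqrt 2 * (1 + (4 + 2 * A) / (B.Dtmin - 2 * A)) * sectorWidth (m + 1) := by positivity
  have hρfeq : (klScale e₀ m + B.smax * B.Dtmin * (3 * sectorWidth (m + 1) / 4)) / (B.Dtmin - 2 * A) +
      π * Real.sqrt 2 * (1 + (4 + 2 * A) / (B.Dtmin - 2 * A)) * sectorWidth (m + 1) = ρf := hρf.symm
  have hNp := card_support_fatPair_le B hA hADt he hz hz1 hgap hlo hhi hβ hρA (le_refl m) hδF0 hδ hd hd1 hd2 hZ hΦp hGpΦ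
  rw [hρfeq] at hNp
  have hsub : (univ.filter fun q => Gs q ≠ 0) ⊆ (univ.filter fun q => Gp q ≠ 0) := by
    intro q hq
    rw [Finset.mem_filter] at hq ⊢
    exact ⟨hq.1, hincl' q hq.2⟩
  have h3' : (((univ.filter fun q => Gs q ≠ 0).card : ℕ) : ℝ) ≤ (((univ.filter fun q => Gp q ≠ 0).card : ℕ) : ℝ) := by
    exact_mod_cast Finset.card_le_card hsub
  -- (4) the cell
  have hcell : ∀ q, Gs q ≠ 0 → ‖torusCentredMomentum L q.2 - klFermiPoint μ K (sectorCenter (m + 1) (ω : ℕ))‖ ≤ ρf := by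
    intro q hq
    rw [hGsΦ] at hq
    obtain ⟨hGne, hZne⟩ := hincl _ _ hq
    have hshell : |frameLevel μ K (WithLp.toLp 2 fun j => 2 * π / L * (((q.2 j).valMinAbs : ℤ) : ℝ))| ≤ klScale e₀ m := by
      by_contra hlt
      have hlt' : klScale e₀ m < |eK fun j => 2 * π / L * (((q.2 j).valMinAbs : ℤ) : ℝ)| := not_le.1 hlt
      have hbig : klScale e₀ m ^ 2 < (π * (1 - 2 * M) / β + 2 * π / β * (((q.1 0).val : ℕ) : ℝ)) ^ 2 +
          (eK fun j => 2 * π / L * (((q.2 j).valMinAbs : ℤ) : ℝ)) ^ 2 := by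
        have h := pow_lt_pow_left₀ hlt' hΛ.le two_ne_zero
        rw [sq_abs] at h; exact lt_of_lt_of_le h (le_add_of_nonneg_left (sq_nonneg _))
      exact hGne (hGv _ hbig)
    have hsq : ∀ i, |(fun j => 2 * π / L * (((q.2 j).valMinAbs : ℤ) : ℝ)) i| ≤ π + z := by
      intro i
      have := abs_torusCentredMomentum_le_pi L q.2 i
      rw [torusCentredMomentum_eq_valMinAbs] at this
      linarith only [this, hz]
    have h := fatPair_cell B hA hADt he hz hz1 hgap hlo hhi hδ hZ _ hsq hshell hZne
    rw [hρfeq, ← torusCentredMomentum_eq_valMinAbs] at h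
    exact h
  -- (5) the tangency datum on the support
  have hτE : ∀ q, Gs q ≠ 0 → |fderiv ℝ (frameLevel μ K) (WithLp.toLp 2 (torusCentredMomentum L q.2)) (WithLp.toLp 2 (fun i => 2 * π / L * (v i : ℝ)))| ≤
      τ₀ + K₂ * (Real.sqrt 2 * ρf) * ‖(WithLp.toLp 2 (fun i => 2 * π / L * (v i : ℝ)) : EuclideanSpace ℝ (Fin 2))‖ :=
    fun q hq => sliceTangency_of_cell μ K hK₂ Gs v _ hvtan hcell q hq
  exact ⟨h1, hincl', h3'.trans hNp, hcell, hτE⟩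

end IncrPairData

end Summit.HubbardSuperconductivity.HubbardSuperconductivity.Theorems.TorusFourierL2

end
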